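import Summits.Ventures.LatticeQCDFlow.Scaling.HubChainStartContentDeficitSharp
import Summits.Ventures.LatticeQCDFlow.Scaling.HubChainStartContentCoverPair

/-!
HONEST FRAMING: exact (Metropolis-corrected) sampling algorithms for lattice gauge theory; figures
of merit are autocorrelation/cost numbers at stated couplings and volumes; no continuum-physics
claim.

# HubChainStartContentDeficitResidual — THE START-CLASS DEFICIT IN THE RESIDUAL CONFIGURATION (TAG ALONE AT RANK 0, START CLASS ALONE AT RANK 1, `cM_0 = 1 + c`):
# `e_{n+1} = c·e_n + ((β^Y_1)ⁿ⁺¹ − (β^X_1)ⁿ⁺¹) − (gap terms)`, HENCE `e_n ≤ cⁿ·(g_n(α_Y) − g_n(α_X))` WITH `g_n(t) = −(t + (−t)ⁿ⁺¹)/(1+t)`, `α = ρ_0/ρ_1`: NO DEFICIT AT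
# ODD `n`, AND `e_n ≤ cⁿ·α_X(1 − α_Xⁿ)/(1 + α_X) ≤ cⁿα_X/(1+α_X)` AT EVEN `n` (lean-2 GEN-41, ours)

Venture-side (OURS).  Cell `lqcd-flow` (pub-lqcd), unit `pub-lqcd-lean-2-g41`, 2026-08-30.  Chapter AA (route (β), the cost side), file 2.  File 1 (`…DeficitSharp`) bounds the per-step
start-class deficit `e_n = P_Yⁿ(i,i) − P_Xⁿ(i,i)` by `(β^X_i − β^Y_i)(max{0,−β^X_i})ⁿ⁻¹` whenever three particles sit at ranks `≤ i`.  The one configuration left (Z7's) is the tag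
alone at rank `0` and the start class alone at rank `1` (`N_0 = N_1 = 1`, `cM_0 = 1 + c`, everything else deeper), where `T_n(1)` is NOT antitone in `ρ_0`.  There file 1's exact
recursion closes on itself: with `α_X = ρ^X_0/ρ_1 ≤ α_Y = ρ^Y_0/ρ_1 ≤ 1` (`β^X_1 = −cα_X`, `β^Y_1 = −cα_Y`, Z7 `coverB_levels`) and `P_Y(1,1) = β^Y_1 + c` (Y7),

* §1 **`residual_deficit_succ` (exact):** `e_{n+1} = c·e_n + ((β^Y_1)ⁿ⁺¹ − (β^X_1)ⁿ⁺¹) − Σ_{l≥2}(P_Xⁿ(1,l) − P_Yⁿ(1,l))P_X(l,1)`; `residual_deficit_succ_le`: `e_{n+1} ≤ c·e_n +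
  ((β^Y_1)ⁿ⁺¹ − (β^X_1)ⁿ⁺¹)` (Z2 at the deeper classes, each carrying `≥ 1` particle);
* §2 scalar: `g_n(t) = (−t − (−t)ⁿ⁺¹)/(1+t)` has `g_0 = 0`, `g_{n+1}(t) = g_n(t) + (−t)ⁿ⁺¹` (`residual_g_zero`, `residual_g_succ`); for odd `n`, `g_n` is non-increasing on `[0,∞)`
  (`residual_g_odd_anti`, from `(1+a)(1+b)(f(b) − f(a)) = (b−a) + (bⁿ⁺¹−aⁿ⁺¹) + ab(bⁿ−aⁿ)`, `f(t) = (t+tⁿ⁺¹)/(1+t)`); for even `n`, `−t/(1+t) ≤ g_n(t) ≤ 0` on `[0,1]`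
  (`residual_g_even_le`, `residual_g_even_ge`);
* §3 **`residual_deficit_le_g`:** `e_n ≤ cⁿ(g_n(α_Y) − g_n(α_X))` for every `n` (induction); **`residual_deficit_odd`:** `e_n ≤ 0` at odd `n`; **`residual_deficit_even`:**
  `e_n ≤ cⁿ·α_X/(1+α_X)` at even `n` — for the star (`c = 1/K`, `α_X = W_ζ/W_a = acc(ζ,a)`): `e_n ≤ K⁻ⁿ·acc(ζ,a)/(1+acc(ζ,a))`, zero at odd attempt counts, the discounted
  deficit `D ≤ (acc(ζ,a)/(1+acc(ζ,a)))·Σ_{even n}w_nK⁻ⁿ` — explicit and proportional to `X`'s tag acceptance, which is what the first-step ★-income of `X`'s certificate is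
  proportional to (memo MEMO-gen41; toy: equality in the `K = 2` family of MEMO-gen40 §5).

Literature grade (cell rule): OWN, elementary; nothing cited; no new bib keys.
-/

open Finset

namespace Summit.Ventures.LatticeQCDFlow.Scaling

/-! ### §2 (scalar) The alternating sums `g_n` -/
section ResidualScalar

/-- `g_0 = 0`. [ours] -/
theorem residual_g_zero {g : ℕ → ℝ → ℝ} (hg : ∀ n t, g n t = (-t - (-t) ^ (n + 1)) / (1 + t)) {t : ℝ} (ht : 0 ≤ t) : g 0 t = 0 := by
  rw [hg, pow_one]; have : (1 + t) ≠ 0 := by linarith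
  field_simp; ring

/-- `g_{n+1}(t) = g_n(t) + (−t)ⁿ⁺¹`. [ours] -/
theorem residual_g_succ {g : ℕ → ℝ → ℝ} (hg : ∀ n t, g n t = (-t - (-t) ^ (n + 1)) / (1 + t)) (n : ℕ) {t : ℝ} (ht : 0 ≤ t) :
    g (n + 1) t = g n t + (-t) ^ (n + 1) := by
  rw [hg, hg]; have : (1 + t) ≠ 0 := by linarith
  field_simp
  ring

/-- **Odd `n`: `g_n` is non-increasing on `[0,∞)`** (`g_n(t) = −(t + tⁿ⁺¹)/(1+t)`). [ours] -/
theorem residual_g_odd_anti {g : ℕ → ℝ → ℝ} (hg : ∀ n t, g n t = (-t - (-t) ^ (n + 1)) / (1 + t)) {n : ℕ} (hn : Odd n) {a b : ℝ} (ha : 0 ≤ a) (hab : a ≤ b) :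
    g n b ≤ g n a := by
  have hb : 0 ≤ b := ha.trans hab
  have hev : Even (n + 1) := hn.add_one
  rw [hg, hg, hev.neg_pow, hev.neg_pow]
  have ha1 : 0 < 1 + a := by linarith
  have hb1 : 0 < 1 + b := by linarith
  rw [div_le_div_iff₀ hb1 ha1]
  -- `(1+a)(1+b)(f(b) − f(a)) = (b−a) + (bⁿ⁺¹−aⁿ⁺¹) + ab(bⁿ−aⁿ) ≥ 0`
  have h1 : a ^ (n + 1) ≤ b ^ (n + 1) := pow_le_pow_left₀ ha hab _
  have h2 : a ^ n ≤ b ^ n := pow_le_pow_left₀ ha hab _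
  have h3 : 0 ≤ a * b := mul_nonneg ha hb
  have key : (-a - a ^ (n + 1)) * (1 + b) - (-b - b ^ (n + 1)) * (1 + a) = (b - a) + (b ^ (n + 1) - a ^ (n + 1)) + a * b * (b ^ n - a ^ n) := by ring
  nlinarith [mul_nonneg h3 (sub_nonneg.mpr h2)]

/-- **Even `n`: `g_n(t) ≤ 0` on `[0,1]`** (`g_n(t) = −(t − tⁿ⁺¹)/(1+t)`, `tⁿ⁺¹ ≤ t`). [ours] -/
theorem residual_g_even_le {g : ℕ → ℝ → ℝ} (hg : ∀ n t, g n t = (-t - (-t) ^ (n + 1)) / (1 + t)) {n : ℕ} (hn : Even n) {t : ℝ} (ht : 0 ≤ t) (ht1 : t ≤ 1) :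
    g n t ≤ 0 := by
  have hod : Odd (n + 1) := hn.add_one
  rw [hg, hod.neg_pow]
  have h : t ^ (n + 1) ≤ t := by
    calc t ^ (n + 1) ≤ t ^ 1 := pow_le_pow_of_le_one ht ht1 (by omega)
      _ = t := pow_one t
  exact div_nonpos_of_nonpos_of_nonneg (by linarith) (by linarith)

/-- **Even `n`: `g_n(t) ≥ −t(1 − tⁿ)/(1+t) ≥ −t/(1+t)`** on `[0,∞)` (stated as `−g_n(t) ≤ t/(1+t)`). [ours] -/
theorem residual_g_even_ge {g : ℕ → ℝ → ℝ} (hg : ∀ n t, g n t = (-t - (-t) ^ (n + 1)) / (1 + t)) {n : ℕ} (hn : Even n) {t : ℝ} (ht : 0 ≤ t) :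
    -g n t ≤ t / (1 + t) := by
  have hod : Odd (n + 1) := hn.add_one
  rw [hg, hod.neg_pow]
  have ht1 : 0 < 1 + t := by linarith
  rw [← neg_div, div_le_div_iff₀ ht1 ht1]
  nlinarith [pow_nonneg ht (n + 1)]

end ResidualScalar

/-! ### §1 and §3 The residual configuration -/
section Residual
variable {m : ℕ} {ρX ρY N RX RY M βX βY a : ℕ → ℝ} {c : ℝ} {PX PY fX fY : ℕ → ℕ → ℝ} {PnX PnY : ℕ → ℕ → ℕ → ℝ} {TX TY : ℕ → ℕ → ℝ}

/-- **THE EXACT RECURSION IN THE RESIDUAL CONFIGURATION** (`s = 0`, `i = 1`, `N_0 = N_1 = 1`, `cM_0 = 1 + c`):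
`e_{n+1} = c·e_n + ((β^Y_1)ⁿ⁺¹ − (β^X_1)ⁿ⁺¹) − Σ_{l≥2}(P_Xⁿ(1,l) − P_Yⁿ(1,l))·P_X(l,1)`. [ours] -/
theorem residual_deficit_succ (hρX : ∀ i, 0 < ρX i) (hmonoX : Monotone ρX) (hρY : ∀ i, 0 < ρY i) (hmonoY : Monotone ρY)
    (hagree : ∀ i, i ≠ 0 → ρX i = ρY i) (hN : ∀ i, 0 < N i)
    (hRX : ∀ k, RX k = ∑ i ∈ range k, N i * ρX i) (hRY : ∀ k, RY k = ∑ i ∈ range k, N i * ρY i) (hM : ∀ k, M k = ∑ i ∈ Ico k m, N i)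
    (hPXoff : ∀ i j, i ≠ j → PX i j = c * N j * min 1 (ρX j / ρX i)) (hPXdiag : ∀ i, PX i i = 1 - ∑ j ∈ (range m).erase i, PX i j)
    (hPYoff : ∀ i j, i ≠ j → PY i j = c * N j * min 1 (ρY j / ρY i)) (hPYdiag : ∀ i, PY i i = 1 - ∑ j ∈ (range m).erase i, PY i j)
    (hfX : ∀ k i, fX k i = if i < k then ρX k else if i = k then -(RX k / N k) else 0)
    (hfY : ∀ k i, fY k i = if i < k then ρY k else if i = k then -(RY k / N k) else 0)
    (hβX : ∀ k, βX k = 1 - c * (M k + RX k / ρX k)) (hβY : ∀ k, βY k = 1 - c * (M k + RY k / ρY k)) (ha : ∀ l, a l = 1 - c * M (l + 1))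
    (hPX0 : ∀ i j, PnX 0 i j = if i = j then 1 else 0) (hPXs : ∀ n i j, PnX (n + 1) i j = ∑ l ∈ range m, PnX n i l * PX l j)
    (hPY0 : ∀ i j, PnY 0 i j = if i = j then 1 else 0) (hPYs : ∀ n i j, PnY (n + 1) i j = ∑ l ∈ range m, PnY n i l * PY l j)
    (hTX : ∀ n j, TX n j = (1 - βX j ^ n) / RX m + ∑ k ∈ Ico (j + 1) m, (1 / RX k - 1 / RX (k + 1)) * (βX k ^ n - βX j ^ n))
    (hTY : ∀ n j, TY n j = (1 - βY j ^ n) / RY m + ∑ k ∈ Ico (j + 1) m, (1 / RY k - 1 / RY (k + 1)) * (βY k ^ n - βY j ^ n))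
    (hc : 0 ≤ c) (hcK : c * M 0 = 1 + c) (hN0 : N 0 = 1) (hN1 : N 1 = 1) (hm : 1 < m) (n : ℕ) :
    PnY (n + 1) 1 1 - PnX (n + 1) 1 1
      = c * (PnY n 1 1 - PnX n 1 1) + (βY 1 ^ (n + 1) - βX 1 ^ (n + 1))
        - ∑ l ∈ ((range m).erase 1).erase 0, (PnX n 1 l - PnY n 1 l) * PX l 1 := by
  rw [sharp_deficit_succ hρX hmonoX hρY hmonoY hagree hN hRX hRY hM hPXoff hPXdiag hPYoff hPYdiag hfX hfY hβX hβY hPX0 hPXs hPY0 hPYs hTX hTY n zero_lt_one hm]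
  obtain ⟨-, -, hbX, hbY, -, -⟩ := coverB_levels hρY hmonoY hagree hRX hRY hM hβX hβY ha hcK hN0 hN1 hm hc
  have hdX := hubClass_pow_diag hρX hmonoX hN hRX hM hPXoff hPXdiag hfX hβX hPX0 hPXs hTX n hm
  have hdY := hubClass_pow_diag hρY hmonoY hN hRY hM hPYoff hPYdiag hfY hβY hPY0 hPYs hTY n hm
  have hPY11 : PY 1 1 = βY 1 + c * N 1 := hubClass_diag hρY hmonoY hRY hM hPYoff hPYdiag hβY hm
  have hρ1 : ρY 1 = ρX 1 := (hagree 1 one_ne_zero).symm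
  rw [hρ1] at hdY
  rw [hN1] at hdX hdY hPY11
  have hρX1 : ρX 1 ≠ 0 := (hρX 1).ne'
  -- `ρ_1·T = Pⁿ(1,1) − βⁿ`
  have hTXe : TX n 1 = (PnX n 1 1 - βX 1 ^ n) / ρX 1 := by rw [hdX]; field_simp; ring
  have hTYe : TY n 1 = (PnY n 1 1 - βY 1 ^ n) / ρX 1 := by rw [hdY]; field_simp; ring
  have hcρ : c * ρY 0 = -(βY 1) * ρX 1 := by rw [hbY]; field_simp
  have key : c * N 1 * N 0 * ρY 0 * (TY n 1 - TX n 1) = -(βY 1) * ((PnY n 1 1 - βY 1 ^ n) - (PnX n 1 1 - βX 1 ^ n)) := by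
    rw [hN0, hN1, hTXe, hTYe, show c * 1 * 1 * ρY 0 = c * ρY 0 by ring, hcρ]
    field_simp
  rw [key, hPY11]
  ring

/-- **… hence `e_{n+1} ≤ c·e_n + ((β^Y_1)ⁿ⁺¹ − (β^X_1)ⁿ⁺¹)`** (every class weight `≥ 1`, so the deeper classes are dominated, Z2). [ours] -/
theorem residual_deficit_succ_le (hρX : ∀ i, 0 < ρX i) (hmonoX : Monotone ρX) (hρY : ∀ i, 0 < ρY i) (hmonoY : Monotone ρY)
    (hagree : ∀ i, i ≠ 0 → ρX i = ρY i) (htag : ρX 0 ≤ ρY 0) (hN : ∀ i, 0 < N i) (hNge : ∀ i, 1 ≤ N i)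
    (hRX : ∀ k, RX k = ∑ i ∈ range k, N i * ρX i) (hRY : ∀ k, RY k = ∑ i ∈ range k, N i * ρY i) (hM : ∀ k, M k = ∑ i ∈ Ico k m, N i)
    (hPXoff : ∀ i j, i ≠ j → PX i j = c * N j * min 1 (ρX j / ρX i)) (hPXdiag : ∀ i, PX i i = 1 - ∑ j ∈ (range m).erase i, PX i j)
    (hPYoff : ∀ i j, i ≠ j → PY i j = c * N j * min 1 (ρY j / ρY i)) (hPYdiag : ∀ i, PY i i = 1 - ∑ j ∈ (range m).erase i, PY i j)
    (hfX : ∀ k i, fX k i = if i < k then ρX k else if i = k then -(RX k / N k) else 0)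
    (hfY : ∀ k i, fY k i = if i < k then ρY k else if i = k then -(RY k / N k) else 0)
    (hβX : ∀ k, βX k = 1 - c * (M k + RX k / ρX k)) (hβY : ∀ k, βY k = 1 - c * (M k + RY k / ρY k)) (ha : ∀ l, a l = 1 - c * M (l + 1))
    (hPX0 : ∀ i j, PnX 0 i j = if i = j then 1 else 0) (hPXs : ∀ n i j, PnX (n + 1) i j = ∑ l ∈ range m, PnX n i l * PX l j)
    (hPY0 : ∀ i j, PnY 0 i j = if i = j then 1 else 0) (hPYs : ∀ n i j, PnY (n + 1) i j = ∑ l ∈ range m, PnY n i l * PY l j)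
    (hTX : ∀ n j, TX n j = (1 - βX j ^ n) / RX m + ∑ k ∈ Ico (j + 1) m, (1 / RX k - 1 / RX (k + 1)) * (βX k ^ n - βX j ^ n))
    (hTY : ∀ n j, TY n j = (1 - βY j ^ n) / RY m + ∑ k ∈ Ico (j + 1) m, (1 / RY k - 1 / RY (k + 1)) * (βY k ^ n - βY j ^ n))
    (hc : 0 ≤ c) (hcK : c * M 0 = 1 + c) (hN0 : N 0 = 1) (hN1 : N 1 = 1) (hm : 1 < m) (n : ℕ) :
    PnY (n + 1) 1 1 - PnX (n + 1) 1 1 ≤ c * (PnY n 1 1 - PnX n 1 1) + (βY 1 ^ (n + 1) - βX 1 ^ (n + 1)) := by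
  rw [residual_deficit_succ hρX hmonoX hρY hmonoY hagree hN hRX hRY hM hPXoff hPXdiag hPYoff hPYdiag hfX hfY hβX hβY ha hPX0 hPXs hPY0 hPYs hTX hTY hc hcK hN0 hN1 hm n]
  have hgap : 0 ≤ ∑ l ∈ ((range m).erase 1).erase 0, (PnX n 1 l - PnY n 1 l) * PX l 1 := by
    refine sum_nonneg fun l hl => ?_
    have hl0 : l ≠ 0 := ne_of_mem_erase hl
    have hl' := mem_of_mem_erase hl
    have hl1 : l ≠ 1 := ne_of_mem_erase hl'
    have hlm : l < m := mem_range.mp (mem_of_mem_erase hl')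
    have hl2 : 2 ≤ l := by omega
    -- three particles at ranks `≤ l`: `N_0 + N_1 + N_l ≥ 3`
    have h3 : M (max (max 1 l) 0 + 1) + 3 ≤ M 0 := by
      rw [show max (max 1 l) 0 = l by omega]
      have hM0 : M 0 = N 0 + M 1 := hubClass_M_succ hM (by omega)
      have hM1 : M 1 = N 1 + M 2 := hubClass_M_succ hM hm
      have hMl : M l = N l + M (l + 1) := hubClass_M_succ hM hlm
      have hM2l : M l ≤ M 2 := perStep_M_anti hN hM hl2
      have := hNge l
      rw [hN0] at hM0; rw [hN1] at hM1
      linarith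
    have hdom := perStep_pow_le hρX hmonoX hρY hmonoY hagree htag hN hRX hRY hM hPXoff hPXdiag hPYoff hPYdiag hfX hfY hβX hβY ha hPX0 hPXs hPY0 hPYs
      hTX hTY hc (le_of_eq hcK) n hm hlm (by omega) (Ne.symm hl1) one_ne_zero hl0 h3
    have hP : 0 ≤ PX l 1 := by
      rw [hPXoff l 1 hl1]
      exact mul_nonneg (mul_nonneg hc (hN 1).le) (le_min zero_le_one (div_nonneg (hρX 1).le (hρX l).le))
    exact mul_nonneg (by linarith) hP
  linarith

/-- **`e_n ≤ cⁿ·(g_n(α_Y) − g_n(α_X))`** for every `n` (`α = ρ_0/ρ_1`). [ours] -/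
theorem residual_deficit_le_g (hρX : ∀ i, 0 < ρX i) (hmonoX : Monotone ρX) (hρY : ∀ i, 0 < ρY i) (hmonoY : Monotone ρY)
    (hagree : ∀ i, i ≠ 0 → ρX i = ρY i) (htag : ρX 0 ≤ ρY 0) (hN : ∀ i, 0 < N i) (hNge : ∀ i, 1 ≤ N i)
    (hRX : ∀ k, RX k = ∑ i ∈ range k, N i * ρX i) (hRY : ∀ k, RY k = ∑ i ∈ range k, N i * ρY i) (hM : ∀ k, M k = ∑ i ∈ Ico k m, N i)
    (hPXoff : ∀ i j, i ≠ j → PX i j = c * N j * min 1 (ρX j / ρX i)) (hPXdiag : ∀ i, PX i i = 1 - ∑ j ∈ (range m).erase i, PX i j)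
    (hPYoff : ∀ i j, i ≠ j → PY i j = c * N j * min 1 (ρY j / ρY i)) (hPYdiag : ∀ i, PY i i = 1 - ∑ j ∈ (range m).erase i, PY i j)
    (hfX : ∀ k i, fX k i = if i < k then ρX k else if i = k then -(RX k / N k) else 0)
    (hfY : ∀ k i, fY k i = if i < k then ρY k else if i = k then -(RY k / N k) else 0)
    (hβX : ∀ k, βX k = 1 - c * (M k + RX k / ρX k)) (hβY : ∀ k, βY k = 1 - c * (M k + RY k / ρY k)) (ha : ∀ l, a l = 1 - c * M (l + 1))
    (hPX0 : ∀ i j, PnX 0 i j = if i = j then 1 else 0) (hPXs : ∀ n i j, PnX (n + 1) i j = ∑ l ∈ range m, PnX n i l * PX l j)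
    (hPY0 : ∀ i j, PnY 0 i j = if i = j then 1 else 0) (hPYs : ∀ n i j, PnY (n + 1) i j = ∑ l ∈ range m, PnY n i l * PY l j)
    (hTX : ∀ n j, TX n j = (1 - βX j ^ n) / RX m + ∑ k ∈ Ico (j + 1) m, (1 / RX k - 1 / RX (k + 1)) * (βX k ^ n - βX j ^ n))
    (hTY : ∀ n j, TY n j = (1 - βY j ^ n) / RY m + ∑ k ∈ Ico (j + 1) m, (1 / RY k - 1 / RY (k + 1)) * (βY k ^ n - βY j ^ n))
    {g : ℕ → ℝ → ℝ} (hg : ∀ n t, g n t = (-t - (-t) ^ (n + 1)) / (1 + t))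
    (hc : 0 ≤ c) (hcK : c * M 0 = 1 + c) (hN0 : N 0 = 1) (hN1 : N 1 = 1) (hm : 1 < m) (n : ℕ) :
    PnY n 1 1 - PnX n 1 1 ≤ c ^ n * (g n (ρY 0 / ρX 1) - g n (ρX 0 / ρX 1)) := by
  have hαX : 0 ≤ ρX 0 / ρX 1 := div_nonneg (hρX 0).le (hρX 1).le
  have hαY : 0 ≤ ρY 0 / ρX 1 := div_nonneg (hρY 0).le (hρX 1).le
  obtain ⟨-, -, hbX, hbY, -, -⟩ := coverB_levels hρY hmonoY hagree hRX hRY hM hβX hβY ha hcK hN0 hN1 hm hc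
  induction n with
  | zero => rw [hPY0, hPX0, residual_g_zero hg hαX, residual_g_zero hg hαY]; simp
  | succ n ih =>
      have hstep := residual_deficit_succ_le hρX hmonoX hρY hmonoY hagree htag hN hNge hRX hRY hM hPXoff hPXdiag hPYoff hPYdiag hfX hfY hβX hβY ha hPX0 hPXs hPY0 hPYs
        hTX hTY hc hcK hN0 hN1 hm n
      rw [residual_g_succ hg n hαX, residual_g_succ hg n hαY]
      have hpX : βX 1 ^ (n + 1) = c ^ (n + 1) * (-(ρX 0 / ρX 1)) ^ (n + 1) := by
        rw [hbX, ← mul_pow]; congr 1; ring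
      have hpY : βY 1 ^ (n + 1) = c ^ (n + 1) * (-(ρY 0 / ρX 1)) ^ (n + 1) := by
        rw [hbY, ← mul_pow]; congr 1; ring
      have hmono : c * (PnY n 1 1 - PnX n 1 1) ≤ c * (c ^ n * (g n (ρY 0 / ρX 1) - g n (ρX 0 / ρX 1))) := mul_le_mul_of_nonneg_left ih hc
      calc PnY (n + 1) 1 1 - PnX (n + 1) 1 1 ≤ c * (PnY n 1 1 - PnX n 1 1) + (βY 1 ^ (n + 1) - βX 1 ^ (n + 1)) := hstep
        _ ≤ c * (c ^ n * (g n (ρY 0 / ρX 1) - g n (ρX 0 / ρX 1))) + (βY 1 ^ (n + 1) - βX 1 ^ (n + 1)) := by linarith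
        _ = c ^ (n + 1) * (g n (ρY 0 / ρX 1) + (-(ρY 0 / ρX 1)) ^ (n + 1) - (g n (ρX 0 / ρX 1) + (-(ρX 0 / ρX 1)) ^ (n + 1))) := by
            rw [hpX, hpY, pow_succ]; ring

/-- **NO DEFICIT AT ODD `n` in the residual configuration.** [ours] -/
theorem residual_deficit_odd (hρX : ∀ i, 0 < ρX i) (hmonoX : Monotone ρX) (hρY : ∀ i, 0 < ρY i) (hmonoY : Monotone ρY)
    (hagree : ∀ i, i ≠ 0 → ρX i = ρY i) (htag : ρX 0 ≤ ρY 0) (hN : ∀ i, 0 < N i) (hNge : ∀ i, 1 ≤ N i)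
    (hRX : ∀ k, RX k = ∑ i ∈ range k, N i * ρX i) (hRY : ∀ k, RY k = ∑ i ∈ range k, N i * ρY i) (hM : ∀ k, M k = ∑ i ∈ Ico k m, N i)
    (hPXoff : ∀ i j, i ≠ j → PX i j = c * N j * min 1 (ρX j / ρX i)) (hPXdiag : ∀ i, PX i i = 1 - ∑ j ∈ (range m).erase i, PX i j)
    (hPYoff : ∀ i j, i ≠ j → PY i j = c * N j * min 1 (ρY j / ρY i)) (hPYdiag : ∀ i, PY i i = 1 - ∑ j ∈ (range m).erase i, PY i j)
    (hfX : ∀ k i, fX k i = if i < k then ρX k else if i = k then -(RX k / N k) else 0)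
    (hfY : ∀ k i, fY k i = if i < k then ρY k else if i = k then -(RY k / N k) else 0)
    (hβX : ∀ k, βX k = 1 - c * (M k + RX k / ρX k)) (hβY : ∀ k, βY k = 1 - c * (M k + RY k / ρY k)) (ha : ∀ l, a l = 1 - c * M (l + 1))
    (hPX0 : ∀ i j, PnX 0 i j = if i = j then 1 else 0) (hPXs : ∀ n i j, PnX (n + 1) i j = ∑ l ∈ range m, PnX n i l * PX l j)
    (hPY0 : ∀ i j, PnY 0 i j = if i = j then 1 else 0) (hPYs : ∀ n i j, PnY (n + 1) i j = ∑ l ∈ range m, PnY n i l * PY l j)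
    (hTX : ∀ n j, TX n j = (1 - βX j ^ n) / RX m + ∑ k ∈ Ico (j + 1) m, (1 / RX k - 1 / RX (k + 1)) * (βX k ^ n - βX j ^ n))
    (hTY : ∀ n j, TY n j = (1 - βY j ^ n) / RY m + ∑ k ∈ Ico (j + 1) m, (1 / RY k - 1 / RY (k + 1)) * (βY k ^ n - βY j ^ n))
    (hc : 0 ≤ c) (hcK : c * M 0 = 1 + c) (hN0 : N 0 = 1) (hN1 : N 1 = 1) (hm : 1 < m) {n : ℕ} (hn : Odd n) :
    PnY n 1 1 - PnX n 1 1 ≤ 0 := by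
  obtain ⟨g, hg⟩ : ∃ g : ℕ → ℝ → ℝ, ∀ n t, g n t = (-t - (-t) ^ (n + 1)) / (1 + t) := ⟨_, fun _ _ => rfl⟩
  have h := residual_deficit_le_g hρX hmonoX hρY hmonoY hagree htag hN hNge hRX hRY hM hPXoff hPXdiag hPYoff hPYdiag hfX hfY hβX hβY ha hPX0 hPXs hPY0 hPYs hTX hTY hg
    hc hcK hN0 hN1 hm n
  have hαX : 0 ≤ ρX 0 / ρX 1 := div_nonneg (hρX 0).le (hρX 1).le
  have hle : ρX 0 / ρX 1 ≤ ρY 0 / ρX 1 := div_le_div_of_nonneg_right htag (hρX 1).le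
  have hanti := residual_g_odd_anti hg hn hαX hle
  have : c ^ n * (g n (ρY 0 / ρX 1) - g n (ρX 0 / ρX 1)) ≤ 0 := mul_nonpos_of_nonneg_of_nonpos (pow_nonneg hc n) (by linarith)
  linarith

/-- **AT EVEN `n`: `e_n ≤ cⁿ·α_X/(1 + α_X)`, `α_X = ρ^X_0/ρ_1`** (for the star `K⁻ⁿ·acc(ζ,a)/(1 + acc(ζ,a))`). [ours] -/
theorem residual_deficit_even (hρX : ∀ i, 0 < ρX i) (hmonoX : Monotone ρX) (hρY : ∀ i, 0 < ρY i) (hmonoY : Monotone ρY)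
    (hagree : ∀ i, i ≠ 0 → ρX i = ρY i) (htag : ρX 0 ≤ ρY 0) (hN : ∀ i, 0 < N i) (hNge : ∀ i, 1 ≤ N i)
    (hRX : ∀ k, RX k = ∑ i ∈ range k, N i * ρX i) (hRY : ∀ k, RY k = ∑ i ∈ range k, N i * ρY i) (hM : ∀ k, M k = ∑ i ∈ Ico k m, N i)
    (hPXoff : ∀ i j, i ≠ j → PX i j = c * N j * min 1 (ρX j / ρX i)) (hPXdiag : ∀ i, PX i i = 1 - ∑ j ∈ (range m).erase i, PX i j)
    (hPYoff : ∀ i j, i ≠ j → PY i j = c * N j * min 1 (ρY j / ρY i)) (hPYdiag : ∀ i, PY i i = 1 - ∑ j ∈ (range m).erase i, PY i j)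
    (hfX : ∀ k i, fX k i = if i < k then ρX k else if i = k then -(RX k / N k) else 0)
    (hfY : ∀ k i, fY k i = if i < k then ρY k else if i = k then -(RY k / N k) else 0)
    (hβX : ∀ k, βX k = 1 - c * (M k + RX k / ρX k)) (hβY : ∀ k, βY k = 1 - c * (M k + RY k / ρY k)) (ha : ∀ l, a l = 1 - c * M (l + 1))
    (hPX0 : ∀ i j, PnX 0 i j = if i = j then 1 else 0) (hPXs : ∀ n i j, PnX (n + 1) i j = ∑ l ∈ range m, PnX n i l * PX l j)
    (hPY0 : ∀ i j, PnY 0 i j = if i = j then 1 else 0) (hPYs : ∀ n i j, PnY (n + 1) i j = ∑ l ∈ range m, PnY n i l * PY l j)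
    (hTX : ∀ n j, TX n j = (1 - βX j ^ n) / RX m + ∑ k ∈ Ico (j + 1) m, (1 / RX k - 1 / RX (k + 1)) * (βX k ^ n - βX j ^ n))
    (hTY : ∀ n j, TY n j = (1 - βY j ^ n) / RY m + ∑ k ∈ Ico (j + 1) m, (1 / RY k - 1 / RY (k + 1)) * (βY k ^ n - βY j ^ n))
    (hc : 0 ≤ c) (hcK : c * M 0 = 1 + c) (hN0 : N 0 = 1) (hN1 : N 1 = 1) (hm : 1 < m) {n : ℕ} (hn : Even n) :
    PnY n 1 1 - PnX n 1 1 ≤ c ^ n * ((ρX 0 / ρX 1) / (1 + ρX 0 / ρX 1)) := by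
  obtain ⟨g, hg⟩ : ∃ g : ℕ → ℝ → ℝ, ∀ n t, g n t = (-t - (-t) ^ (n + 1)) / (1 + t) := ⟨_, fun _ _ => rfl⟩
  have h := residual_deficit_le_g hρX hmonoX hρY hmonoY hagree htag hN hNge hRX hRY hM hPXoff hPXdiag hPYoff hPYdiag hfX hfY hβX hβY ha hPX0 hPXs hPY0 hPYs hTX hTY hg
    hc hcK hN0 hN1 hm n
  have hαX : 0 ≤ ρX 0 / ρX 1 := div_nonneg (hρX 0).le (hρX 1).le
  have hαY : 0 ≤ ρY 0 / ρX 1 := div_nonneg (hρY 0).le (hρX 1).le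
  have hαY1 : ρY 0 / ρX 1 ≤ 1 := by
    rw [div_le_one (hρX 1), hagree 1 one_ne_zero]; exact hmonoY zero_le_one
  have h1 := residual_g_even_le hg hn hαY hαY1
  have h2 := residual_g_even_ge hg hn hαX
  have : c ^ n * (g n (ρY 0 / ρX 1) - g n (ρX 0 / ρX 1)) ≤ c ^ n * ((ρX 0 / ρX 1) / (1 + ρX 0 / ρX 1)) :=
    mul_le_mul_of_nonneg_left (by linarith) (pow_nonneg hc n)
  linarith

end Residual

end Summit.Ventures.LatticeQCDFlow.Scaling
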